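import Literature.NumberTheory.GaloisRepresentations.LocalNormQuotientCyclic
import Literature.NumberTheory.GaloisRepresentations.SemiLocalUnitGroupShapiro
import Literature.NumberTheory.Automorphic.AdicCompletionLocalField
import HarnessLib

/-!
# `U(F_v) ⧸ N_{E_w/F_v} U(E_w)` is cyclic for a place `w ∣ v` with CYCLIC decomposition group
# (the completion layer `E_w/F_v` of a Galois extension of number fields)

Topic `NumberTheory/GaloisRepresentations`, namespace `Literature.NumberTheory.GaloisRepresentations.SemiLocal`
(continuing `SemiLocalUnits` / `SemiLocalShapiro` / `SemiLocalUnitGroupShapiro`: `E_w/F_v` is finite Galois with group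
`G_w ≃* Gal(E_w/F_v)`, which preserves the valuation, `valued_algEquiv_place`; `placeUnitGroup w = 𝒪_wˣ`).
Theorems only (no definition, no named fact, no `sorry`).  Cell `bsd-print-cf2`, width seat `bsd-line-cf2c-w3` g14,
`--supports` the deciding class crux stmt-BirchSwinnertonDyer-23300 as a helper: the PER-PLACE form of the
`T`-cyclicity input of the local atom of (U1) (`LocalNormQuotientCyclic.lean` applied to `M = F_v`, `L = E_w`):
the two hypotheses of the abstract lemma are discharged by the tree — `Gal(E_w/F_v)` preserves the `w`-adic
valuation (`valued_galAdicCompletionMap` through `decompMulEquiv`), and `F_v → E_w` raises valuations to the `e`-th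
power (`valued_adicCompletionOfLiesOver`), so units go to units.  HONEST FRAMING: plumbing over landed files;
nothing here closes a crux; BSD is not advanced by this file.

## What is proved (`F E : Type` number fields, `[IsGalois F E]`, `w : Place F E v`)

* `valued_algebraMap_place_eq_one_iff` — `v_w(x) = 1 ↔ v_v(x) = 1` for `x ∈ F_v`;
* `isCyclic_gal_place_of_isCyclic` — `Gal(E_w/F_v)` is cyclic when `G_w` is;
* `forall_norm_mem_exists_place` — a norm from `E_w` which is a unit of `F_v` is the norm of a unit of `E_w`
  (for `H ⊆ U(F_v)`, `U ⊇ U(E_w)`);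
* ★ `isCyclic_quotient_place_of_le` — for `G_w` cyclic, `H ≤ F_vˣ` consisting of units, `U ≤ E_wˣ` containing the
  units and any normal `H' ≤ H` containing `H ∩ N_{E_w/F_v} U`: `H ⧸ H'` is CYCLIC; `index_dvd_card_stabilizer_place_of_le`
  — `[H : H']` divides `#G_w = [E_w : F_v]`;
* ★ `isCyclic_unitGroup_quotient_place_of_le`, `index_unitGroup_dvd_card_stabilizer_place_of_le` — the case
  `H = 𝒪_vˣ` (`(v.adicCompletionIntegers F).unitGroup`), `U = 𝒪_wˣ` (`placeUnitGroup w`): every quotient of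
  `𝒪_vˣ ⧸ N_{E_w/F_v} 𝒪_wˣ` is cyclic of order dividing `#G_w` (Serre V §3: `U_K/NU_L ≅` the inertia group).

## References
* J.-P. Serre, *Local Fields*, GTM 67, Springer 1979, Ch. V §3; Ch. XIII §4 Cor. to Prop. 8. [SerreLocalFields1979]
* J. W. S. Cassels, A. Fröhlich (eds.), *Algebraic Number Theory* (1967), Ch. VII §1.1. [CasselsFrohlichANT1967]
-/

noncomputable section

open NumberField IsDedekindDomain
open Literature.NumberTheory.Automorphic

namespace Literature.NumberTheory.GaloisRepresentations

namespace SemiLocal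

variable {F : Type} [Field F] [NumberField F] {E : Type} [Field E] [NumberField E] [Algebra F E]
variable {v : HeightOneSpectrum (𝓞 F)}

/-- **Units of `F_v` are units of `E_w`**: `v_w(x) = v_v(x)^{e(w|v)}` on `F_v` (`valued_adicCompletionOfLiesOver`),
so `v_w(x) = 1 ↔ v_v(x) = 1`. [cite: CasselsFrohlichANT1967, Ch. VII §1.1] -/
theorem valued_algebraMap_place_eq_one_iff (w : Place F E v) (x : v.adicCompletion F) :
    Valued.v (algebraMap (v.adicCompletion F) ((w : HeightOneSpectrum (𝓞 E)).adicCompletion E) x) = 1 ↔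
      Valued.v x = 1 := by
  rw [algebraMap_place_eq, valued_adicCompletionOfLiesOver]
  have hn : v.asIdeal.ramificationIdx' (w : HeightOneSpectrum (𝓞 E)).asIdeal ≠ 0 :=
    Ideal.IsDedekindDomain.ramificationIdx'_ne_zero_of_liesOver _ v.ne_bot
  constructor
  · intro h
    exact le_antisymm ((pow_le_one_iff hn).mp h.le) ((one_le_pow_iff hn).mp h.ge)
  · intro h
    rw [h, one_pow]

/-- `Gal(E_w/F_v)` is cyclic when the decomposition group `G_w` is (`G_w ≃* Gal(E_w/F_v)`).
[cite: CasselsFrohlichANT1967, Ch. VII §1.1] -/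
theorem isCyclic_gal_place_of_isCyclic [IsGalois F E] (w : Place F E v)
    [IsCyclic (MulAction.stabilizer (E ≃ₐ[F] E) w)] :
    IsCyclic ((w : HeightOneSpectrum (𝓞 E)).adicCompletion E ≃ₐ[v.adicCompletion F]
      (w : HeightOneSpectrum (𝓞 E)).adicCompletion E) :=
  isCyclic_of_surjective (decompMulEquiv w) (decompMulEquiv w).surjective

/-- **A norm from `E_w` which is a unit of `F_v` is the norm of a unit of `E_w`** (indeed of the same element):
the clause of `LocalNormQuotientCyclic` at the place `w`, for any `H ≤ F_vˣ` of units and any `U ≤ E_wˣ` containing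
the units. [cite: SerreLocalFields1979, Ch. V §3] -/
theorem forall_norm_mem_exists_place [IsGalois F E] (w : Place F E v)
    (H : Subgroup (v.adicCompletion F)ˣ) (hH : ∀ x : (v.adicCompletion F)ˣ, x ∈ H → Valued.v (x : v.adicCompletion F) = 1)
    (U : Subgroup ((w : HeightOneSpectrum (𝓞 E)).adicCompletion E)ˣ)
    (hU : ∀ x : ((w : HeightOneSpectrum (𝓞 E)).adicCompletion E)ˣ,
      Valued.v (x : (w : HeightOneSpectrum (𝓞 E)).adicCompletion E) = 1 → x ∈ U) :
    ∀ x : ((w : HeightOneSpectrum (𝓞 E)).adicCompletion E)ˣ,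
      Units.map (Algebra.norm (v.adicCompletion F)
        (S := (w : HeightOneSpectrum (𝓞 E)).adicCompletion E) :
          (w : HeightOneSpectrum (𝓞 E)).adicCompletion E →* v.adicCompletion F) x ∈ H →
      ∃ u ∈ U, Units.map (Algebra.norm (v.adicCompletion F)
          (S := (w : HeightOneSpectrum (𝓞 E)).adicCompletion E) :
            (w : HeightOneSpectrum (𝓞 E)).adicCompletion E →* v.adicCompletion F) u =
        Units.map (Algebra.norm (v.adicCompletion F)
          (S := (w : HeightOneSpectrum (𝓞 E)).adicCompletion E) :
            (w : HeightOneSpectrum (𝓞 E)).adicCompletion E →* v.adicCompletion F) x := by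
  haveI := finiteDimensional_place (K := F) w
  haveI := isGalois_place w
  exact forall_norm_mem_exists_of_valuation ((w : HeightOneSpectrum (𝓞 E)).adicCompletion E) Valued.v
    (valued_algEquiv_place w) H U (fun x hx => (valued_algebraMap_place_eq_one_iff w _).mpr (hH x hx)) hU

/-- ★ **`U(F_v) ⧸ N_{E_w/F_v} U(E_w)` and all its quotients are CYCLIC when the decomposition group `G_w` is cyclic**:
for `H ≤ F_vˣ` consisting of units (`U(F_v)`, the principal units, …), `U ≤ E_wˣ` containing the units, and any
normal `H' ≤ H` containing `H ∩ N_{E_w/F_v}(U)`, the quotient `H ⧸ H'` is cyclic (`↪ F_vˣ ⧸ N E_wˣ ≅ Gal(E_w/F_v) ≅ G_w`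
by the local reciprocity law). The per-place `T`-cyclicity input of the units atom.
[cite: SerreLocalFields1979, Ch. V §3 and Ch. XIII §4 Cor. to Prop. 8] -/
theorem isCyclic_quotient_place_of_le [IsGalois F E] (w : Place F E v)
    [IsCyclic (MulAction.stabilizer (E ≃ₐ[F] E) w)]
    (H : Subgroup (v.adicCompletion F)ˣ) (hH : ∀ x : (v.adicCompletion F)ˣ, x ∈ H → Valued.v (x : v.adicCompletion F) = 1)
    (U : Subgroup ((w : HeightOneSpectrum (𝓞 E)).adicCompletion E)ˣ)
    (hU : ∀ x : ((w : HeightOneSpectrum (𝓞 E)).adicCompletion E)ˣ,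
      Valued.v (x : (w : HeightOneSpectrum (𝓞 E)).adicCompletion E) = 1 → x ∈ U)
    (H' : Subgroup H) [H'.Normal]
    (hle : (U.map (Units.map (Algebra.norm (v.adicCompletion F)
        (S := (w : HeightOneSpectrum (𝓞 E)).adicCompletion E) :
          (w : HeightOneSpectrum (𝓞 E)).adicCompletion E →* v.adicCompletion F))).subgroupOf H ≤ H') :
    IsCyclic (H ⧸ H') := by
  haveI := finiteDimensional_place (K := F) w
  haveI := isGalois_place w
  haveI := isCyclic_gal_place_of_isCyclic w
  exact isCyclic_quotient_of_valuation_le (v.adicCompletion F) ((w : HeightOneSpectrum (𝓞 E)).adicCompletion E)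
    Valued.v (valued_algEquiv_place w) H U
    (fun x hx => (valued_algebraMap_place_eq_one_iff w _).mpr (hH x hx)) hU H' hle

/-- Index form: `[H : H']` divides `#G_w` (`= [E_w : F_v]`) under the same hypotheses.
[cite: SerreLocalFields1979, Ch. XIII §4 Prop. 9] -/
theorem index_dvd_card_stabilizer_place_of_le [IsGalois F E] (w : Place F E v)
    [IsCyclic (MulAction.stabilizer (E ≃ₐ[F] E) w)]
    (H : Subgroup (v.adicCompletion F)ˣ) (hH : ∀ x : (v.adicCompletion F)ˣ, x ∈ H → Valued.v (x : v.adicCompletion F) = 1)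
    (U : Subgroup ((w : HeightOneSpectrum (𝓞 E)).adicCompletion E)ˣ)
    (hU : ∀ x : ((w : HeightOneSpectrum (𝓞 E)).adicCompletion E)ˣ,
      Valued.v (x : (w : HeightOneSpectrum (𝓞 E)).adicCompletion E) = 1 → x ∈ U)
    (H' : Subgroup H)
    (hle : (U.map (Units.map (Algebra.norm (v.adicCompletion F)
        (S := (w : HeightOneSpectrum (𝓞 E)).adicCompletion E) :
          (w : HeightOneSpectrum (𝓞 E)).adicCompletion E →* v.adicCompletion F))).subgroupOf H ≤ H') :
    H'.index ∣ Nat.card (MulAction.stabilizer (E ≃ₐ[F] E) w) := by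
  haveI := finiteDimensional_place (K := F) w
  haveI := isGalois_place w
  haveI := isCyclic_gal_place_of_isCyclic w
  rw [← finrank_place_eq_card_stabilizer w]
  exact index_dvd_finrank_of_valuation_le (v.adicCompletion F) ((w : HeightOneSpectrum (𝓞 E)).adicCompletion E)
    Valued.v (valued_algEquiv_place w) H U
    (fun x hx => (valued_algebraMap_place_eq_one_iff w _).mpr (hH x hx)) hU H' hle

/-- ★ **`𝒪_vˣ ⧸ N_{E_w/F_v} 𝒪_wˣ` and all its quotients are cyclic** when the decomposition group `G_w` is cyclic
(`E/F` Galois number fields, `w ∣ v`): for every normal `H' ≤ 𝒪_vˣ` containing `𝒪_vˣ ∩ N_{E_w/F_v}(𝒪_wˣ)`,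
`𝒪_vˣ ⧸ H'` is cyclic. [cite: SerreLocalFields1979, Ch. V §3 and Ch. XIII §4 Cor. to Prop. 8] -/
theorem isCyclic_unitGroup_quotient_place_of_le [IsGalois F E] (w : Place F E v)
    [IsCyclic (MulAction.stabilizer (E ≃ₐ[F] E) w)]
    (H' : Subgroup (v.adicCompletionIntegers F).unitGroup) [H'.Normal]
    (hle : ((placeUnitGroup w).map (Units.map (Algebra.norm (v.adicCompletion F)
        (S := (w : HeightOneSpectrum (𝓞 E)).adicCompletion E) :
          (w : HeightOneSpectrum (𝓞 E)).adicCompletion E →* v.adicCompletion F))).subgroupOf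
        (v.adicCompletionIntegers F).unitGroup ≤ H') :
    IsCyclic ((v.adicCompletionIntegers F).unitGroup ⧸ H') :=
  isCyclic_quotient_place_of_le w _ (fun x hx => (Valuation.mem_unitGroup_iff _ _ x).mp hx) (placeUnitGroup w)
    (fun x hx => (mem_placeUnitGroup_iff w x).mpr hx) H' hle

/-- Index form: `[𝒪_vˣ : H']` divides `#G_w` for every `H' ⊇ 𝒪_vˣ ∩ N_{E_w/F_v}(𝒪_wˣ)` (`G_w` cyclic).
[cite: SerreLocalFields1979, Ch. XIII §4 Prop. 9] -/
theorem index_unitGroup_dvd_card_stabilizer_place_of_le [IsGalois F E] (w : Place F E v)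
    [IsCyclic (MulAction.stabilizer (E ≃ₐ[F] E) w)]
    (H' : Subgroup (v.adicCompletionIntegers F).unitGroup)
    (hle : ((placeUnitGroup w).map (Units.map (Algebra.norm (v.adicCompletion F)
        (S := (w : HeightOneSpectrum (𝓞 E)).adicCompletion E) :
          (w : HeightOneSpectrum (𝓞 E)).adicCompletion E →* v.adicCompletion F))).subgroupOf
        (v.adicCompletionIntegers F).unitGroup ≤ H') :
    H'.index ∣ Nat.card (MulAction.stabilizer (E ≃ₐ[F] E) w) :=
  index_dvd_card_stabilizer_place_of_le w _ (fun x hx => (Valuation.mem_unitGroup_iff _ _ x).mp hx)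
    (placeUnitGroup w) (fun x hx => (mem_placeUnitGroup_iff w x).mpr hx) H' hle

end SemiLocal

end Literature.NumberTheory.GaloisRepresentations
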